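/-
Copyright: statement-level skeleton of a published paper (lit-balaban cell, Phase-2 proof seat p13, gen 12). No proof
claims beyond what the kernel checks below.
-/
import Literature.MathematicalPhysics.QuantumFieldTheory.BalabanImbrieJaffe1984to88.BIJ88PairingAllOrders5133

/-!
# `BalabanImbrieJaffe1984to88.BIJ88WickSource305` — T. Bałaban, J. Imbrie, A. Jaffe, *Effective action and cluster
properties of the abelian Higgs model*, Commun. Math. Phys. **114** (1988) 257–315 [BalabanImbrieJaffe1988], §5.13
p. 305–306 [PDF 49–50]: **"We integrate by parts all fields appearing in this formula. Each Φ contracts through a C_s to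
another Φ, to an f(□_i) or to ℱ"** — THE COMPLETE CONTRACTION OF A MONOMIAL IN THE FIELDS (no `f(□_i)`: Wick's theorem
for the Gaussian integral with linear term), at every degree.

For `A` positive definite (`= −Δ_s` in tree sign, `C = A⁻¹ = C_s`), `dμ = e^{−½⟨Φ,AΦ⟩}e^{⟨ℱ,Φ⟩}dΦ`, `Z = ∫dμ`, vectors
`v_i` (`i ∈ T`):

  `∫ Π_{i∈T} Φ(v_i) dμ = ( Σ_{σ ∈ smallParts T} Π_{B∈σ} w_B ) · Z`,     (`wick_source`)

the sum over the set partitions of `T` into blocks of ONE OR TWO fields (`BIJ88PairingAllOrders5133.smallParts`), a pair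
`{i,j}` contributing the contraction `w_{{i,j}} = ⟨Cv_i, v_j⟩` (*"Φ contracts through a C_s to another Φ"*) and a
single field the ℱ-train `w_{{i}} = ⟨Cv_i, ℱ⟩` (*"… or to ℱ"*) (`cweight`).  Normalized: `⟨Π_{i∈T}Φ(v_i)⟩ =
Σ_σ Π_B w_B` (`wick_source_expect`).  The two-field case is p13 g6 `BIJ88TruncatedPair306.pair_vacuum` (*"a closed loop
… or … a train of covariances beginning and ending in ℱ"*).  PROOF: induction on `T` — one field is integrated by parts
against the others (p13 g6 `BIJ88IntegrationByParts305.ibp_fields` with `H = 1`), and the small partitions of `T ∪ {j}`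
are those of `T` with `j` alone or paired with one `i ∈ T` (`BIJ88PairingAllOrders5133.sum_smallParts_insert`) — the
same combinatorics as the corrected pairing display (G-C2-24).

statement-level skeleton of published theorems with citation tags; proofs where landed; nothing here is a claim
about the Yang–Mills mass gap

PDF held: `paper:balaban1988-cmp114-bij-abelian-higgs-effective-action` (journal page = PDF page + 256).

CITATION HEADER (lean-in-tree rule).  lit-balaban cell (HOME `run/shared/lean/pub/lit-balaban/`), Phase 2, seat p13
gen 12; row **C2.Eq5.13.3-5.13.4** of `HOME/lit-balaban-r16/ROWS-C2-part2.md` (owner r16, referee ref-5), second clause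
of the flip condition (the post-integration-by-parts walk form): this file supplies the vacuum contractions at every
degree, the building block of the walk expansion of `log N_1` and of the ℱ-ends of the trains.  USED BY NAME, nothing
restated: p13 g6 `BIJ88IntegrationByParts305.ibp_fields`, `isSymm_of_posDef`; p13 g12
`BIJ88PairingAllOrders5133.{smallParts, smallParts_empty, mem_smallParts, sum_smallParts_insert}`; p13 g6
`BIJ88SDerivative305.integral_weight_mul_source_pos`; `Balaban1983to89.B2Eq228Conditioning.{weight, source}`.

## What is proved (0 `sorry`, standard axioms, no new `Prop` facts)

* `cweight` (`w_B`), `cweight_singleton`, `inv_dotProduct_comm` (`⟨Cx,y⟩ = ⟨Cy,x⟩`), `cweight_pair`;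
* **`wick_source`** — the theorem; `wick_source_expect` (normalized form).
HONEST SCOPE.  Finite-dimensional real Gaussian with linear term; pure monomials (no smooth factor `H`; with `H` the
one-step rule is g6 `ibp_fields`).  NOT summit progress; NOT continuum; NOT Clay.  Imports `BIJ88PairingAllOrders5133`;
modifies nothing.
-/

noncomputable section

namespace Literature.MathematicalPhysics.QuantumFieldTheory.BalabanImbrieJaffe1984to88.BIJ88WickSource305

open MeasureTheory Matrix Finset Function Filter
open scoped BigOperators Topology
open Literature.MathematicalPhysics.QuantumFieldTheory.Balaban1983to89
open B2Eq228Conditioning (weight source)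
open BIJ88IntegrationByParts305 (ibp_fields isSymm_of_posDef)
open BIJ88SDerivative305 (integral_weight_mul_source_pos)
open BIJ88PairingAllOrders5133 (smallParts smallParts_empty mem_smallParts sum_smallParts_insert)

variable {S : Type} [Fintype S] [DecidableEq S] {κ : Type} [DecidableEq κ]

/-- **Contraction weights** of a block of fields: `w_{{i}} = ⟨Cv_i,ℱ⟩` (the field contracts to ℱ), `w_{{i,j}} = ⟨Cv_i,v_j⟩`
(the field contracts to another field; written symmetrically), `C = A⁻¹`. [cite: BalabanImbrieJaffe1988, §5.13 p.305–306] -/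
def cweight (A : Matrix S S ℝ) (f : S → ℝ) (v : κ → S → ℝ) (B : Finset κ) : ℝ :=
  if B.card = 1 then ∑ i ∈ B, (A⁻¹ *ᵥ v i) ⬝ᵥ f
  else (1/2 : ℝ) * ∑ i ∈ B, ∑ j ∈ B.erase i, (A⁻¹ *ᵥ v i) ⬝ᵥ v j

/-- `w_{{i}} = ⟨Cv_i,ℱ⟩`. [cite: BalabanImbrieJaffe1988, §5.13 p.305–306] -/
theorem cweight_singleton (A : Matrix S S ℝ) (f : S → ℝ) (v : κ → S → ℝ) (i : κ) :
    cweight A f v {i} = (A⁻¹ *ᵥ v i) ⬝ᵥ f := by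
  simp [cweight]

omit [DecidableEq S] in
/-- `⟨Cx,y⟩ = ⟨Cy,x⟩` for `A` positive definite (`C = A⁻¹` is symmetric). [cite: BalabanImbrieJaffe1988, §5.13 p.305] -/
theorem inv_dotProduct_comm [DecidableEq S] {A : Matrix S S ℝ} (hA : A.PosDef) (x y : S → ℝ) :
    (A⁻¹ *ᵥ x) ⬝ᵥ y = (A⁻¹ *ᵥ y) ⬝ᵥ x := by
  have hs : A.IsSymm := isSymm_of_posDef hA
  have hinv : (A⁻¹)ᵀ = A⁻¹ := by
    rw [transpose_nonsing_inv, hs.eq]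
  calc (A⁻¹ *ᵥ x) ⬝ᵥ y = y ⬝ᵥ (A⁻¹ *ᵥ x) := dotProduct_comm _ _
    _ = (y ᵥ* A⁻¹) ⬝ᵥ x := dotProduct_mulVec _ _ _
    _ = ((A⁻¹)ᵀ *ᵥ y) ⬝ᵥ x := by rw [mulVec_transpose]
    _ = (A⁻¹ *ᵥ y) ⬝ᵥ x := by rw [hinv]

/-- `w_{{i,j}} = ⟨Cv_i,v_j⟩` (`i ≠ j`). [cite: BalabanImbrieJaffe1988, §5.13 p.305–306] -/
theorem cweight_pair {A : Matrix S S ℝ} (hA : A.PosDef) (f : S → ℝ) (v : κ → S → ℝ) {i j : κ} (hij : i ≠ j) :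
    cweight A f v {i, j} = (A⁻¹ *ᵥ v i) ⬝ᵥ v j := by
  have e0 : ({i, j} : Finset κ).erase i = {j} := by
    rw [erase_insert (by simpa using hij)]
  have e1 : ({i, j} : Finset κ).erase j = {i} := by
    rw [pair_comm, erase_insert (by simpa using hij.symm)]
  rw [cweight, if_neg (by rw [card_pair hij]; norm_num), sum_pair hij, e0, e1, sum_singleton, sum_singleton,
    inv_dotProduct_comm hA (v j) (v i)]
  ring

/-- **WICK'S THEOREM WITH LINEAR TERM** (*"Each Φ contracts through a C_s to another Φ … or to ℱ"*, complete
contraction of a monomial): `∫ Π_{i∈T}Φ(v_i) e^{−½⟨Φ,AΦ⟩}e^{⟨ℱ,Φ⟩}dΦ = (Σ_{σ ∈ smallParts T} Π_{B∈σ} w_B) · Z`, the sum over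
the set partitions of `T` into pairs (contractions `⟨Cv_i,v_j⟩`) and singletons (ℱ-trains `⟨Cv_i,ℱ⟩`).
[cite: BalabanImbrieJaffe1988, §5.13 p.305–306] -/
theorem wick_source (A : Matrix S S ℝ) (hA : A.PosDef) (f : S → ℝ) (v : κ → S → ℝ) (T : Finset κ) :
    ∫ φ : S → ℝ, (∏ i ∈ T, φ ⬝ᵥ v i) * (weight A φ * source f φ)
      = (∑ σ ∈ smallParts T, ∏ B ∈ σ, cweight A f v B) * ∫ φ : S → ℝ, weight A φ * source f φ := by
  induction T using Finset.strongInduction with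
  | H T ih =>
    rcases T.eq_empty_or_nonempty with hT | ⟨j, hj⟩
    · subst hT
      simp [smallParts_empty]
    · have hT : insert j (T.erase j) = T := insert_erase hj
      have hj' : j ∉ T.erase j := notMem_erase j T
      have hsub : T.erase j ⊂ T := erase_ssubset hj
      -- one field against the others (g6 `ibp_fields` with `H = 1`)
      have hD1 : ∀ ψ : S → ℝ, fderiv ℝ (fun _ : S → ℝ => (1:ℝ)) ψ = 0 := fun ψ => fderiv_const_apply (1:ℝ)
      have hD1' : ∀ ψ u : S → ℝ, fderiv ℝ (fun _ : S → ℝ => (1:ℝ)) ψ u = 0 := fun ψ u => by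
        rw [hD1]
        rfl
      have hibp := ibp_fields A hA f (T.erase j) v (H := fun _ => (1:ℝ)) contDiff_const (K₀ := 1) (K₁ := 0)
        (fun _ => by simp) (fun ψ => by rw [hD1]; simp) (v j)
      simp only [mul_one, hD1', mul_zero, zero_mul, integral_zero, add_zero] at hibp
      have e : ∫ φ : S → ℝ, (∏ i ∈ T, φ ⬝ᵥ v i) * (weight A φ * source f φ)
          = ∫ φ : S → ℝ, (φ ⬝ᵥ v j) * (∏ i ∈ T.erase j, φ ⬝ᵥ v i) * (weight A φ * source f φ) := by
        congr 1
        funext φ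
        rw [← Finset.mul_prod_erase T (fun i => φ ⬝ᵥ v i) hj]
      rw [e, hibp, ih _ hsub, sum_congr rfl fun i hi => by rw [ih _ ((erase_ssubset hi).trans hsub)]]
      -- the small partitions of `T = T.erase j ∪ {j}`
      rw [← hT, sum_smallParts_insert hj']
      have hA1 : ∑ σ ∈ smallParts (T.erase j), ∏ B ∈ insert ({j} : Finset κ) σ, cweight A f v B
          = (A⁻¹ *ᵥ v j) ⬝ᵥ f * ∑ σ ∈ smallParts (T.erase j), ∏ B ∈ σ, cweight A f v B := by
        rw [mul_sum]
        refine sum_congr rfl fun σ hσ => ?_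
        have hP := (mem_smallParts.1 hσ).1
        have hjσ : ({j} : Finset κ) ∉ σ := fun h => hj' (hP.subset h (mem_singleton_self j))
        rw [prod_insert hjσ, cweight_singleton]
      have hA2 : ∑ i ∈ T.erase j, ∑ σ ∈ smallParts ((T.erase j).erase i),
            ∏ B ∈ insert ({i, j} : Finset κ) σ, cweight A f v B
          = ∑ i ∈ T.erase j, (A⁻¹ *ᵥ v j) ⬝ᵥ v i
              * ∑ σ ∈ smallParts ((T.erase j).erase i), ∏ B ∈ σ, cweight A f v B := by
        refine sum_congr rfl fun i hi => ?_
        rw [mul_sum]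
        refine sum_congr rfl fun σ hσ => ?_
        have hP := (mem_smallParts.1 hσ).1
        have hij : i ≠ j := fun e => hj' (e ▸ hi)
        have hijσ : ({i, j} : Finset κ) ∉ σ := fun h =>
          (notMem_erase i (T.erase j)) (hP.subset h (mem_insert_self i {j}))
        rw [prod_insert hijσ, cweight_pair hA f v hij, inv_dotProduct_comm hA (v i) (v j)]
      rw [hA1, hA2, insert_erase hj]
      conv_rhs => rw [add_mul, Finset.sum_mul]
      rw [add_comm]
      congr 1
      · ring
      · exact sum_congr rfl fun i _ => by ring

/-- Normalized form: `⟨Π_{i∈T}Φ(v_i)⟩ = Σ_{σ ∈ smallParts T} Π_{B∈σ} w_B`. [cite: BalabanImbrieJaffe1988, §5.13 p.305–306] -/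
theorem wick_source_expect (A : Matrix S S ℝ) (hA : A.PosDef) (f : S → ℝ) (v : κ → S → ℝ) (T : Finset κ) :
    (∫ φ : S → ℝ, (∏ i ∈ T, φ ⬝ᵥ v i) * (weight A φ * source f φ)) / (∫ φ : S → ℝ, weight A φ * source f φ)
      = ∑ σ ∈ smallParts T, ∏ B ∈ σ, cweight A f v B := by
  have hZ : (∫ φ : S → ℝ, weight A φ * source f φ) ≠ 0 := (integral_weight_mul_source_pos hA f).ne'
  rw [wick_source A hA f v T, mul_div_assoc, div_self hZ, mul_one]

end Literature.MathematicalPhysics.QuantumFieldTheory.BalabanImbrieJaffe1984to88.BIJ88WickSource305
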